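import Mathlib
import HarnessLib
import HarnessLib.Audit
import Summits.ValiantsHypothesis.ValiantsHypothesis.Theorems.LacunarySymmetroidMatrixDescartesToyALawMain
import Summits.ValiantsHypothesis.ValiantsHypothesis.Theorems.LacunarySymmetroidMatrixDescartesADictionary

/-!
# ValiantsHypothesis / LacunarySymmetroid — crux `MatrixDescartes` (stmt-ValiantsHypothesis-18050, V1), LINE (A) «product_plus_one»:
# the TOY THEOREM stated on the LINE's own A-function at `η ≡ 0`

NOTE §54.12/§54.13 (pen val-idea-25 g8): «A_toy is the `η_f → 0` limit of `A/(1−ξ)` in the variable `Y = e^x`, `t_f = e^{u_f}`».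
With the A-function typed over the pen g9 Sketch objects (`ADictionary.Afun`, module `…ADictionary`) this is an IDENTITY at
`η ≡ 0` (`Afun_eta_zero`), and the kernel TOY THEOREM (`ToyALaw.toyALaw_ncard`, module `…ToyALawMain`) becomes a statement about
the LINE's own object: for `0 < ξ < 1`, `r > 0` and positive weights, the real zero set of `x ↦ A(x)` at `η ≡ 0` (the pen's
`zeroSet ξ r kc u 0 λ`) is finite with at most `2r − 1` elements (`afun_eta_zero_zeros`).

HONEST FRAMING: the binomial-limit corner only (`η_f = 0`, modulators `M ≡ 1`); says nothing about `η_f > 0` (the A-LAW, T1†, T′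
are located statements of the NOTE, untyped as theorems); no stub of LINE (A) is touched (A40 unchanged, sorries 4 → 4);
`MatrixDescartes` OPEN; `VP ≠ VNP` is NOT proved and nothing here bears on it.
-/

set_option linter.dupNamespace false

namespace Summit.ValiantsHypothesis.ValiantsHypothesis.Theorems.LacunarySymmetroidMatrixDescartes

namespace ADictionary

open Real Finset

/-- The fixed kernel in the variable `Y = e^x`, `t = e^u`: `κ(x − u) = t²(Y − τt)/(Y + t)³`. -/
theorem kappa_sub_eq (ξ x u : ℝ) :
    kappa ξ (x - u) = Real.exp u ^ 2 * (Real.exp x - ξ / (1 - ξ) * Real.exp u) / (Real.exp x + Real.exp u) ^ 3 := by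
  rw [kappa, Real.exp_sub]
  have hu : Real.exp u ≠ 0 := (Real.exp_pos u).ne'
  have hs : Real.exp x + Real.exp u ≠ 0 := by positivity
  field_simp
  ring

/-- **NOTE §54.12 at `η ≡ 0`**: `A(x) = (1−ξ)·A_toy(e^x)` with `t_f = e^{u_f}`, `τ = ξ/(1−ξ)` (the TOY object `ToyALaw.toyA`). -/
theorem Afun_eta_zero (ξ : ℝ) (r : ℕ) (kc : Fin r → Bool) (u lam : Fin r → ℝ) (x : ℝ) :
    Afun ξ r kc u (fun _ => 0) lam x =
      (1 - ξ) * ToyALaw.toyA (fun f => Real.exp (u f)) lam (ξ / (1 - ξ)) (Real.exp x) := by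
  rw [Afun, ToyALaw.toyA, mul_sum]
  refine sum_congr rfl fun f _ => ?_
  rw [rowKernel_eta_zero, kappa_sub_eq]
  ring

/-- **TOY THEOREM on the LINE's A-function (binomial limit)**: for `0 < ξ < 1`, `r > 0` and `λ_f > 0`, at `η ≡ 0` the real zero
set of `A` is finite with at most `2r − 1` elements (the pen's `zeroSet ξ r kc u 0 λ`; arbitrary scales `u_f` and types `kc`). -/
theorem afun_eta_zero_zeros {ξ : ℝ} (hξ0 : 0 < ξ) (hξ1 : ξ < 1) {r : ℕ} (hr : 0 < r) (kc : Fin r → Bool)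
    (u lam : Fin r → ℝ) (hlam : ∀ f, 0 < lam f) :
    {x : ℝ | Afun ξ r kc u (fun _ => 0) lam x = 0}.Finite ∧
      {x : ℝ | Afun ξ r kc u (fun _ => 0) lam x = 0}.ncard ≤ 2 * r - 1 := by
  set t : Fin r → ℝ := fun f => Real.exp (u f) with ht
  have htpos : ∀ f, 0 < t f := fun f => Real.exp_pos _
  have hτ : 0 < ξ / (1 - ξ) := div_pos hξ0 (by linarith)
  obtain ⟨hfin, hcard⟩ := ToyALaw.toyALaw_ncard r t lam (ξ / (1 - ξ)) hr hτ htpos hlam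
  set ZY : Set ℝ := {Y : ℝ | 0 < Y ∧ ToyALaw.Atoy r t lam (ξ / (1 - ξ)) Y = 0} with hZY
  have hmaps : ∀ x ∈ {x : ℝ | Afun ξ r kc u (fun _ => 0) lam x = 0}, Real.exp x ∈ ZY := by
    intro x hx
    have hx' : Afun ξ r kc u (fun _ => 0) lam x = 0 := hx
    rw [Afun_eta_zero, mul_eq_zero] at hx'
    refine ⟨Real.exp_pos x, ?_⟩
    rw [ToyALaw.Atoy_eq_toyA]
    exact hx'.resolve_left (by linarith)
  have hinj : Set.InjOn Real.exp {x : ℝ | Afun ξ r kc u (fun _ => 0) lam x = 0} :=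
    Real.exp_injective.injOn
  refine ⟨Set.Finite.of_injOn hmaps hinj hfin, ?_⟩
  exact (Set.ncard_le_ncard_of_injOn Real.exp hmaps hinj hfin).trans hcard

end ADictionary

end Summit.ValiantsHypothesis.ValiantsHypothesis.Theorems.LacunarySymmetroidMatrixDescartes
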